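import Literature.Computability.MetaComplexity.HeuristicClasses
import Literature.Computability.Complexity.PlumbingBricks
import HarnessLib

/-!
# `AvgP` is closed under heuristic polynomial-time reductions (proof)

Third sibling proof file of `HeuristicClasses.lean` (D-0014: named facts `def X : Prop` are
discharged as `theorem X_holds : X`). This file discharges

* `Literature.Computability.MetaComplexity.mem_AvgP_of_polyTimeReducible_holds :
  mem_AvgP_of_polyTimeReducible` — if `(L₁, D₁) ≤_{AvgP} (L₂, D₂)` (`DistProblem.PolyTimeReducible`)
  and `(L₂, D₂) ∈ AvgP`, then `(L₁, D₁) ∈ AvgP`.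

## The printed proof and the proof here

Bogdanov–Trevisan, *Average-Case Complexity* (2006), Lemma 3.2 (= Lemma 24 of the ECCC / arXiv
version, §4.1, p. 21): let `A'` be an errorless heuristic scheme for `(L', D')`, `f` the
reduction, `p`, `m` the domination polynomials; then `A(x; n, δ) := A'(f(x; n); m(n), δ/p(n))` is
an errorless heuristic scheme for `(L, D)`: with `B` the set of `y` on which
`A'(y; m(n), δ/p(n)) = ⊥`,
`Pr_{x ∼ Dₙ}[A(x; n, δ) = ⊥] = Σ_{y ∈ B} Dₙ{x | f(x; n) = y} ≤ Σ_{y ∈ B} p(n) D'_{m(n)}(y)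
  = p(n) · D'_{m(n)}(B) ≤ δ`.

The vendored form passes `δ = 1/k` in unary (`schemeEnc (x, n, k) = ⟨x, ⟨1ⁿ, 1ᵏ⟩⟩`), so the
scheme built here is `A(x, 1ⁿ, 1ᵏ) := A'(f(x; n), 1^{m(n)}, 1^{K})` with the failure parameter
`K = K(n, k) := (X · (p + 1))(|⟨1ⁿ, 1ᵏ⟩|) = (2n + k + 2) · (p(2n + k + 2) + 1) ≥ k · p(n)`
(any polynomially bounded `K ≥ k · p(n)` computable in unary from `⟨1ⁿ, 1ᵏ⟩` does; this one is
the unary value of a polynomial of the *length* of the parameter block, which the tree's brick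
`Plumb.polyFn` computes, so no unary multiplication machine is needed). The three clauses of `AvgP`:

* *polynomial time*: the instance transformer
  `⟨x, ⟨1ⁿ, 1ᵏ⟩⟩ ↦ ⟨f(x; n), ⟨1^{m(n)}, 1^{K}⟩⟩` is a total `FP` string function assembled from
  existing bricks — the reduction as a total function (`mem_FP_of_unaryArg`, `PairPlumbing.lean`),
  record projections `Brick.fstF` / `Brick.sndF`, fan-out `fanoutFn`, and `Plumb.polyFn`
  (`1^{Q(|w|)}`) — and is then composed with the machine of `A'`
  (`PolyTimeComputable.comp_holds`);
* *errorless on the support*: domination sends `supp D₁,ₙ` into `supp D₂,ₘ₍ₙ₎` (a fibre of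
  positive `D₁,ₙ`-mass has positive `D₂,ₘ₍ₙ₎`-mass, `apply_mem_support_of_dominated`), where `A'`
  is errorless, and correctness of `f` on `supp D₁,ₙ` translates the answer;
* *failure probability*: the displayed computation, as the push-forward bound
  `D₁,ₙ{x | f(x; n) ∈ S} ≤ p(n) · D₂,ₘ₍ₙ₎(S)` (`toOuterMeasure_setOf_apply_mem_le_of_dominated`,
  via `PMF.map`), then `p(n) · (1/K) ≤ 1/k`.

## References

* A. Bogdanov, L. Trevisan, *Average-Case Complexity*, Found. Trends TCS 2 (2006), no. 1, §3.1,
  Def. 3.1 and Lemma 3.2; ECCC TR06-073 / arXiv:cs/0606037, §4.1, Def. 23 and Lemma 24 (p. 21).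
* L. Levin, *Average case complete problems*, SIAM J. Comput. 15 (1986), 285–286.
* S. Arora, B. Barak, *Computational Complexity: A Modern Approach*, CUP 2009, §1.3 (closure of
  polynomial time under composition).
-/

namespace Literature.Computability.MetaComplexity

open _root_.Computability Complexity Polynomial
open scoped ENNReal

/-! ### Small arithmetic facts -/

/-- `|1ⁿ| = n` for Mathlib's unary encoding (`unaryDecodeNat` is `List.length`, so this is
`Computability.unary_decode_encode_nat`; private copy, cf. `DistProblemsProofs.lean`).
[Mathlib `Computability.unary_decode_encode_nat`] [folklore] -/
private theorem length_unaryEncodeNat_eq' (n : ℕ) : (unaryEncodeNat n).length = n :=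
  unary_decode_encode_nat n

/-- The outer measure of a `PMF` is at most `1` on every set.
[Mathlib `PMF.toOuterMeasure_apply_eq_one_iff`] [folklore] -/
private theorem pmf_toOuterMeasure_le_one' (q : PMF (List Bool)) (S : Set (List Bool)) :
    q.toOuterMeasure S ≤ 1 :=
  calc q.toOuterMeasure S ≤ q.toOuterMeasure Set.univ := q.toOuterMeasure.mono (Set.subset_univ _)
    _ = 1 := (PMF.toOuterMeasure_apply_eq_one_iff _ _).2 (Set.subset_univ _)

/-! ### Domination: push-forward of events and of the support -/

/-- **Domination bounds push-forward probabilities of events.** If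
`D₁,ₙ{x | f(x; n) = y} ≤ p(n) · D₂,ₘ₍ₙ₎(y)` for every `y` (the domination condition of
`IsDominatedVia`), then for every event `S`,
`D₁,ₙ{x | f(x; n) ∈ S} ≤ p(n) · D₂,ₘ₍ₙ₎(S)`: write the left side as the outer measure of `S`
under the push-forward `PMF.map (f(·; n)) D₁,ₙ`, i.e. `Σ_{y ∈ S} D₁,ₙ{x | f(x; n) = y}`, and bound
termwise. This is the displayed chain of (in)equalities in the printed proof.
[Bogdanov–Trevisan 2006, proof of Lemma 3.2 (ECCC TR06-073, proof of Lemma 24, p. 21)]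
[cite: BogdanovTrevisan2006, Lemma 3.2 (proof)] -/
theorem toOuterMeasure_setOf_apply_mem_le_of_dominated {D₁ D₂ : Ensemble}
    {f : List Bool → ℕ → List Bool} {p m : Polynomial ℕ}
    (h : ∀ (n : ℕ) (y : List Bool),
      (D₁ n).toOuterMeasure {x | f x n = y} ≤ ((p.eval n : ℕ) : ℝ≥0∞) * (D₂ (m.eval n)) y)
    (n : ℕ) (S : Set (List Bool)) :
    (D₁ n).toOuterMeasure {x | f x n ∈ S} ≤
      ((p.eval n : ℕ) : ℝ≥0∞) * (D₂ (m.eval n)).toOuterMeasure S := by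
  have hmap : (D₁ n).toOuterMeasure {x | f x n ∈ S} =
      ((D₁ n).map fun x => f x n).toOuterMeasure S :=
    (PMF.toOuterMeasure_map_apply _ _ _).symm
  rw [hmap, PMF.toOuterMeasure_apply, PMF.toOuterMeasure_apply, ← ENNReal.tsum_mul_left]
  refine ENNReal.tsum_le_tsum fun y => ?_
  by_cases hy : y ∈ S
  · rw [Set.indicator_of_mem hy, Set.indicator_of_mem hy,
      ← PMF.toOuterMeasure_apply_singleton ((D₁ n).map fun x => f x n) y,
      PMF.toOuterMeasure_map_apply]
    exact h n y
  · simp [hy]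

/-- **Domination sends supports into supports.** Under the domination condition, if
`x ∈ supp D₁,ₙ` then `f(x; n) ∈ supp D₂,ₘ₍ₙ₎`: the fibre `{x' | f(x'; n) = f(x; n)}` contains `x`,
so it has positive `D₁,ₙ`-mass, hence `p(n) · D₂,ₘ₍ₙ₎(f(x; n)) > 0`. (Implicit in the printed
proof, where the bad set is "restricted to the support of `D'ₘ`"; it is what makes
support-relative errorlessness and correctness compose.)
[Bogdanov–Trevisan 2006, Def. 3.1 and proof of Lemma 3.2 (ECCC TR06-073, Def. 23, Lemma 24)]
[cite: BogdanovTrevisan2006, Def. 3.1 / Lemma 3.2] -/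
theorem apply_mem_support_of_dominated {D₁ D₂ : Ensemble} {f : List Bool → ℕ → List Bool}
    {p m : Polynomial ℕ}
    (h : ∀ (n : ℕ) (y : List Bool),
      (D₁ n).toOuterMeasure {x | f x n = y} ≤ ((p.eval n : ℕ) : ℝ≥0∞) * (D₂ (m.eval n)) y)
    {n : ℕ} {x : List Bool} (hx : x ∈ (D₁ n).support) : f x n ∈ (D₂ (m.eval n)).support := by
  rw [PMF.mem_support_iff] at hx ⊢
  intro h0
  apply hx
  have h1 : (D₁ n).toOuterMeasure {x' | f x' n = f x n} = 0 := by
    have h2 := h n (f x n)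
    rw [h0, mul_zero] at h2
    exact nonpos_iff_eq_zero.1 h2
  have h3 : (D₁ n) x ≤ (D₁ n).toOuterMeasure {x' | f x' n = f x n} := by
    rw [← PMF.toOuterMeasure_apply_singleton (D₁ n) x]
    exact (D₁ n).toOuterMeasure.mono (Set.singleton_subset_iff.2 rfl)
  rw [h1] at h3
  exact nonpos_iff_eq_zero.1 h3

/-! ### The instance transformer is polynomial time -/

/-- **The instance transformer of the reduced scheme is polynomial time.** For a reduction map
`f(x; n)` polynomial-time computable from `⟨x, 1ⁿ⟩` (`paramEnc`) and polynomials `m`, `Q`, the map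
`(x, n, k) ↦ (f(x; n), m(n), Q(|⟨1ⁿ, 1ᵏ⟩|))` is polynomial-time from scheme encoding to scheme
encoding: on `w = ⟨x, ⟨1ⁿ, 1ᵏ⟩⟩` the total `FP` function
`⟨F ⟨fst w, fst (snd w)⟩, ⟨1^{m(|fst (snd w)|)}, 1^{Q(|snd w|)}⟩⟩` — with `F` the reduction as a
total function (`mem_FP_of_unaryArg`), the projections `Brick.fstF`/`Brick.sndF`, `fanoutFn` and
`Plumb.polyFn` — outputs `⟨f(x; n), ⟨1^{m(n)}, 1^{Q(2n + k + 2)}⟩⟩`, so the same machine computes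
the map between scheme encodings (`PolyTimeComputable.of_encode`). This is the "compute `m(n)`
and the new failure parameter, then call `A'`" step of the printed proof, made explicit.
[Bogdanov–Trevisan 2006, proof of Lemma 3.2; Arora–Barak 2009, §1.3 (composition)]
[cite: BogdanovTrevisan2006, Lemma 3.2 (proof)] -/
theorem polyTimeComputable_schemeEnc_reduceParams {f : List Bool → ℕ → List Bool}
    (hf : PolyTimeComputable paramEnc (id : List Bool → List Bool) (Function.uncurry f))
    (m Q : Polynomial ℕ) :
    PolyTimeComputable schemeEnc schemeEnc fun q : List Bool × ℕ × ℕ =>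
      (f q.1 q.2.1, m.eval q.2.1,
        Q.eval (boolPair (unaryEncodeNat q.2.1) (unaryEncodeNat q.2.2)).length) := by
  -- the reduction as a total `FP` string function `w ↦ f (boolUnpair w).1 |(boolUnpair w).2|`
  have hF : (fun w => f (boolUnpair w).1 (boolUnpair w).2.length) ∈ FP := mem_FP_of_unaryArg hf
  -- transport the total `FP` function along `schemeEnc` (same machine, same polynomial)
  refine PolyTimeComputable.of_encode
    (F := fanoutFn ((fun w => f (boolUnpair w).1 (boolUnpair w).2.length) ∘
        fanoutFn Brick.fstF (Brick.fstF ∘ Brick.sndF))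
      (fanoutFn (Plumb.polyFn m ∘ Brick.fstF ∘ Brick.sndF) (Plumb.polyFn Q ∘ Brick.sndF)))
    (fanoutFn_mem_FP
      (comp_mem_FP hF
        (fanoutFn_mem_FP Brick.fstF_mem_FP (comp_mem_FP Brick.fstF_mem_FP Brick.sndF_mem_FP)))
      (fanoutFn_mem_FP
        (comp_mem_FP (Plumb.polyFn_mem_FP m) (comp_mem_FP Brick.fstF_mem_FP Brick.sndF_mem_FP))
        (comp_mem_FP (Plumb.polyFn_mem_FP Q) Brick.sndF_mem_FP)))
    schemeEnc (fun _ => rfl) fun q => ?_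
  obtain ⟨x, n, k⟩ := q
  simp [schemeEnc, unaryEncodeNat_eq_replicate]

/-! ### Closure of `AvgP` under reductions -/

/-- **The reduced errorless heuristic scheme** (the content of Bogdanov–Trevisan's Lemma 3.2 for
`C = AvgP`, with the reduction unbundled). Given a polynomial-time map `f(x; n)` that is correct on
`supp D₁,ₙ` and along which `D₁` is dominated by `D₂` with polynomials `p` (factor) and `m`
(parameter), and an errorless heuristic scheme `A'(y, 1ⁿ, 1ᵏ)` for `(L₂, D₂)` (polynomial time on
`schemeEnc`, errorless on `supp D₂,ₙ` for every `k`, failure probability `≤ 1/k` for `k > 0`), the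
scheme `A(x, 1ⁿ, 1ᵏ) := A'(f(x; n), 1^{m(n)}, 1^{K})`, `K = (2n + k + 2)(p(2n + k + 2) + 1) ≥ k·p(n)`,
witnesses `(L₁, D₁) ∈ AvgP`: it is polynomial time (`polyTimeComputable_schemeEnc_reduceParams` and
composition), errorless on `supp D₁,ₙ` (domination maps supports to supports, then correctness of
`f`), and `Pr_{x ∼ D₁,ₙ}[A = ⊥] ≤ p(n) · Pr_{y ∼ D₂,ₘ₍ₙ₎}[A'(y, 1^{m(n)}, 1^K) = ⊥] ≤ p(n)/K ≤ 1/k`.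
The printed proof takes `δ' = δ/p(n)` exactly; here `1/K ≤ 1/(k·p(n))` is any smaller polynomial
failure parameter, which only helps.
[Bogdanov–Trevisan 2006, Lemma 3.2 (ECCC TR06-073 / arXiv:cs/0606037, Lemma 24, p. 21); Levin 1986]
[cite: BogdanovTrevisan2006, Lemma 3.2] -/
theorem mem_AvgP_of_dominated_errorlessScheme {Q₁ Q₂ : DistProblem}
    {f : List Bool → ℕ → List Bool} {p m : Polynomial ℕ}
    (hf : PolyTimeComputable paramEnc (id : List Bool → List Bool) (Function.uncurry f))
    (hcorr : ∀ n, ∀ x ∈ (Q₁.dist n).support, f x n ∈ Q₂.lang ↔ x ∈ Q₁.lang)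
    (hdom : ∀ (n : ℕ) (y : List Bool),
      (Q₁.dist n).toOuterMeasure {x | f x n = y} ≤
        ((p.eval n : ℕ) : ℝ≥0∞) * (Q₂.dist (m.eval n)) y)
    {A : List Bool → ℕ → ℕ → Option Bool}
    (hA : PolyTimeComputable schemeEnc optBoolEnc fun q : List Bool × ℕ × ℕ => A q.1 q.2.1 q.2.2)
    (herr : ∀ k, IsErrorlessFor (fun y n => A y n k) Q₂)
    (hfail : ∀ n k, 0 < k → Q₂.dist.prob n {y | A y n k = none} ≤ 1 / k) :
    Q₁ ∈ AvgP := by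
  refine ⟨fun x n k => A (f x n) (m.eval n)
      ((X * (p + 1)).eval (boolPair (unaryEncodeNat n) (unaryEncodeNat k)).length), ?_, ?_, ?_⟩
  · -- polynomial time: instance transformer, then `A'`
    exact PolyTimeComputable.comp_holds hA (polyTimeComputable_schemeEnc_reduceParams hf m _)
  · -- errorless on the support
    intro k n x hx b hb
    have hy : f x n ∈ (Q₂.dist (m.eval n)).support := apply_mem_support_of_dominated hdom hx
    rw [herr _ (m.eval n) (f x n) hy b hb]
    by_cases h1 : x ∈ Q₁.lang
    · rw [(Set.mem_iff_boolIndicator _ _).1 h1,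
        (Set.mem_iff_boolIndicator _ _).1 ((hcorr n x hx).2 h1)]
    · rw [(Set.notMem_iff_boolIndicator _ _).1 h1,
        (Set.notMem_iff_boolIndicator _ _).1 (mt (hcorr n x hx).1 h1)]
  · -- failure probability
    intro n k hk
    show Q₁.dist.prob n {x | A (f x n) (m.eval n)
      ((X * (p + 1)).eval (boolPair (unaryEncodeNat n) (unaryEncodeNat k)).length) = none} ≤ 1 / (k : ℝ)
    -- the failure parameter `K` and its size
    have hL : (boolPair (unaryEncodeNat n) (unaryEncodeNat k)).length = 2 * n + 2 + k := by
      rw [length_boolPair, length_unaryEncodeNat_eq', length_unaryEncodeNat_eq']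
    have hKeq : (X * (p + 1)).eval (boolPair (unaryEncodeNat n) (unaryEncodeNat k)).length =
        (2 * n + 2 + k) * (p.eval (2 * n + 2 + k) + 1) := by
      rw [hL, eval_mul, eval_X, eval_add, eval_one]
    generalize (X * (p + 1)).eval (boolPair (unaryEncodeNat n) (unaryEncodeNat k)).length = K
      at hKeq ⊢
    have hpk : p.eval n * k ≤ K := by
      rw [hKeq]
      calc p.eval n * k ≤ (p.eval (2 * n + 2 + k) + 1) * (2 * n + 2 + k) :=
            Nat.mul_le_mul ((TM2Iter.eval_mono p (by omega)).trans (Nat.le_succ _)) (by omega)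
        _ = (2 * n + 2 + k) * (p.eval (2 * n + 2 + k) + 1) := Nat.mul_comm _ _
    have hKpos : 0 < K := by
      rw [hKeq]
      exact Nat.mul_pos (by omega) (Nat.succ_pos _)
    -- push the failure event forward along `f`
    have hev := toOuterMeasure_setOf_apply_mem_le_of_dominated hdom n {y | A y (m.eval n) K = none}
    have hfin : ((p.eval n : ℕ) : ℝ≥0∞) *
        (Q₂.dist (m.eval n)).toOuterMeasure {y | A y (m.eval n) K = none} ≠ ⊤ :=
      ENNReal.mul_ne_top (ENNReal.natCast_ne_top _)
        (ne_top_of_le_ne_top ENNReal.one_ne_top (pmf_toOuterMeasure_le_one' _ _))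
    have hreal : Q₁.dist.prob n {x | A (f x n) (m.eval n) K = none} ≤
        ((p.eval n : ℕ) : ℝ) * Q₂.dist.prob (m.eval n) {y | A y (m.eval n) K = none} := by
      have h' := ENNReal.toReal_mono hfin hev
      rw [ENNReal.toReal_mul, ENNReal.toReal_natCast] at h'
      exact h'
    have h2 := hfail (m.eval n) K hKpos
    calc Q₁.dist.prob n {x | A (f x n) (m.eval n) K = none}
        ≤ ((p.eval n : ℕ) : ℝ) * Q₂.dist.prob (m.eval n) {y | A y (m.eval n) K = none} := hreal
      _ ≤ ((p.eval n : ℕ) : ℝ) * (1 / K) := mul_le_mul_of_nonneg_left h2 (Nat.cast_nonneg _)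
      _ ≤ 1 / k := by
        rw [mul_one_div, div_le_div_iff₀ (by exact_mod_cast hKpos) (by exact_mod_cast hk),
          one_mul]
        exact_mod_cast hpk

/-- **Discharge of `mem_AvgP_of_polyTimeReducible`** (`AvgP` is closed under heuristic
polynomial-time reductions): unbundle the reduction `(f, correctness on the support, domination
with polynomials p, m)` and the `AvgP` witness of `Q₂`, and apply
`mem_AvgP_of_dominated_errorlessScheme` — run the scheme for `Q₂` on `f(x; n)` with parameter
`m(n)` and a failure parameter `K ≥ k · p(n)`; domination transfers the failure probability.
[Bogdanov–Trevisan 2006, Lemma 3.2 (ECCC TR06-073 / arXiv:cs/0606037, §4.1, Lemma 24, p. 21);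
Levin 1986] [cite: BogdanovTrevisan2006, Lemma 3.2] -/
theorem mem_AvgP_of_polyTimeReducible_holds : mem_AvgP_of_polyTimeReducible := by
  intro Q₁ Q₂ h h₂
  obtain ⟨f, hf, hcorr, p, m, hdom⟩ := h
  obtain ⟨A, hA, herr, hfail⟩ := h₂
  exact mem_AvgP_of_dominated_errorlessScheme hf hcorr hdom hA herr hfail

end Literature.Computability.MetaComplexity
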